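import Mathlib.InformationTheory.KullbackLeibler.Basic
import Summits.AtomisticToContinuum.FouriersLaw.Theorems.ExtensiveSnapshotIrreversibility.Negative.TiltedCriterion
import Literature.MathematicalPhysics.KineticTheory.LangevinChainKernel
import Literature.MathematicalPhysics.KineticTheory.LangevinChainGibbs
import Literature.MathematicalPhysics.KineticTheory.LangevinChainNESSHolds
import Literature.Probability.LatticeModels.BoxDirichlet
import HarnessLib

/-!
# Crux `ExtensiveSnapshotIrreversibility` (stmt-AtomisticToContinuum-9121), line `clausius-budget-sound-window`:
REDUCTION of stub S1c `stub_snapshotKLUpper` to the one missing fixed-`N` analytic statement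

Registered sub-goal `stub_snapshotKLUpper_of_density` of the lead's skeleton (v4): the UPPER half of the second-order
expansion of the snapshot divergence `KL(μ_δ ‖ Θ_*μ_δ) ≤ K δ²` (every `K > ½∫(h − h∘Θ)² dμ_{N,T,T}`, eventually in
`δ ≠ 0`) follows from the INTRINSIC LOG-DENSITY STATEMENT (the hypothesis, = skeleton stub `stub_oddLogDensity`,
unprinted for the hypoelliptic chain): eventually in `δ ≠ 0` the steady state has an everywhere positive measurable
Lebesgue density `ρ_δ` whose odd log-part satisfies `∫ (log ρ_δ − log ρ_δ∘Θ)² dμ_δ ≤ D δ²` for every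
`D > ∫ (h − h∘Θ)² dμ_{N,T,T}` (first-order control in quadratic mean of the odd McLennan expansion
`log ρ_δ − log ρ_δ∘Θ = δ(h − h∘Θ) + o(δ)`; MaesNetocny2010 Thm 3.1 is conditional on smooth density dependence,
KomatsuNakagawaSasaTasaki2011 is physics, EckmannPilletReyBellet1999a gives one-sided control only).

Tools (all proved here, no new definitions; `sinh x ≤ x cosh x` is imported from `Literature.Probability.LatticeModels`): the SHARP pointwise inequality `(a − b)(e^a − e^b) ≤ ½(a − b)²(e^a + e^b)`
(`tanh(x/2) ≤ x/2`), hence the SHARP tilted upper bound `KL(μ₀.tilted φ ‖ Θ_*·) ≤ ½ ∫ (φ − φ∘Θ)² d(μ₀.tilted φ)` for a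
flip-invariant probability measure `μ₀` (sharpening the landed `Negative.klDiv_flip_tilted_le_integral_sq` by the factor
2 that S1c's constant needs), its Gibbs specialisation, and the rewriting of a positive Lebesgue probability density as
the Gibbs tilt by `log ρ + H/T` (whose odd part is `log ρ − log ρ∘Θ`, `H` being even in the momenta).
Written by a stub-worker of the lead (scratch `SnapshotKLUpperOf.lean`), assembled def-free by the lead.
-/

noncomputable section

namespace Summit.AtomisticToContinuum.FouriersLaw.Theorems.ExtensiveSnapshotIrreversibility.ClausiusBudget

open MeasureTheory Filter Topology InformationTheory Real
open scoped ENNReal NNReal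
open Literature.MathematicalPhysics.KineticTheory.HeatConduction
open Summit.AtomisticToContinuum.FouriersLaw.Theorems.ExtensiveSnapshotIrreversibility.Negative

/-! ## 1. The sharp pointwise inequality -/

/-! ## 1. The sharp pointwise inequality -/

/-- `u sinh u ≤ u² cosh u` for every real `u` (both sides even in `u`). [folklore] -/
theorem mul_sinh_le_sq_mul_cosh (u : ℝ) : u * sinh u ≤ u ^ 2 * cosh u := by
  rcases le_total 0 u with h | h
  · have h1 := mul_le_mul_of_nonneg_left (Literature.Probability.LatticeModels.sinh_le_mul_cosh h) h
    nlinarith [h1]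
  · have h' : sinh (-u) ≤ (-u) * cosh (-u) := Literature.Probability.LatticeModels.sinh_le_mul_cosh (by linarith)
    rw [sinh_neg, cosh_neg] at h'
    have h2 : u * cosh u ≤ sinh u := by linarith
    have h3 := mul_le_mul_of_nonpos_left h2 h
    nlinarith [h3]

/-- **Sharp pointwise inequality**: `(a − b)(e^a − e^b) ≤ ½ (a − b)² (e^a + e^b)`, i.e.
`tanh(x/2) ≤ x/2` for `x = a − b ≥ 0` (logarithmic mean ≤ arithmetic mean). [folklore] -/
theorem sub_mul_exp_sub_exp_le_half (a b : ℝ) :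
    (a - b) * (exp a - exp b) ≤ (a - b) ^ 2 * (exp a + exp b) / 2 := by
  set u : ℝ := (a - b) / 2 with hu
  have ha : exp a = exp ((a + b) / 2) * exp u := by rw [← exp_add]; congr 1; rw [hu]; ring
  have hb : exp b = exp ((a + b) / 2) * exp (-u) := by rw [← exp_add]; congr 1; rw [hu]; ring
  have hm := exp_pos ((a + b) / 2)
  have h1 : exp a - exp b = exp ((a + b) / 2) * (2 * sinh u) := by rw [ha, hb, Real.sinh_eq]; ring
  have h2 : exp a + exp b = exp ((a + b) / 2) * (2 * cosh u) := by rw [ha, hb, Real.cosh_eq]; ring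
  have hab : a - b = 2 * u := by rw [hu]; ring
  rw [h1, h2, hab]
  have key := mul_le_mul_of_nonneg_left (mul_sinh_le_sq_mul_cosh u) hm.le
  nlinarith [key]

/-! ## 2. The sharp upper half of the tilted sandwich -/

variable {N : ℕ} {μ₀ : Measure (PhaseSpace N)}

/-- **Sharp tilted upper bound.** For `μ = μ₀.tilted φ` with `μ₀` a flip-invariant probability measure and
`d := φ − φ∘Θ ∈ L²(μ)`: `KL(μ ‖ Θ_*μ) ≤ ½ ∫ d² dμ` (finite in particular).  Proof: `KL = ∫ d dμ
= (2Z)⁻¹ ∫ d (e^φ − e^{φ∘Θ}) dμ₀` by flip-antisymmetry of `d`, then `sub_mul_exp_sub_exp_le_half` and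
flip-invariance of `μ₀`.  Sharpens `klDiv_flip_tilted_le_integral_sq` by the factor `2`. [folklore] -/
theorem klDiv_flip_tilted_le_half_integral_sq [IsProbabilityMeasure μ₀]
    (hinv : μ₀.map (fun x : PhaseSpace N => (x.1, -x.2)) = μ₀)
    {φ : PhaseSpace N → ℝ} (hφm : Measurable φ) (hexp : Integrable (fun x => exp (φ x)) μ₀)
    (h2 : Integrable (fun x => (φ x - φ (x.1, -x.2)) ^ 2) (μ₀.tilted φ)) :
    klDiv (μ₀.tilted φ) ((μ₀.tilted φ).map (fun x : PhaseSpace N => (x.1, -x.2))) ≤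
      ENNReal.ofReal ((1 / 2 : ℝ) * ∫ x, (φ x - φ (x.1, -x.2)) ^ 2 ∂(μ₀.tilted φ)) := by
  set d : PhaseSpace N → ℝ := fun x => φ x - φ (x.1, -x.2) with hd
  have hdm : Measurable d := hφm.sub (hφm.comp (momentumReversal N).measurable)
  have hdodd : ∀ x : PhaseSpace N, d (x.1, -x.2) = -d x := fun x => by
    simp [hd]
  haveI : IsProbabilityMeasure (μ₀.tilted φ) := isProbabilityMeasure_tilted hexp
  -- `d ∈ L¹(μ)` from `d ∈ L²(μ)` (probability space): `|d| ≤ 1 + d²`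
  have h1 : Integrable d (μ₀.tilted φ) := by
    refine Integrable.mono' ((integrable_const (1 : ℝ)).add h2) hdm.aestronglyMeasurable
      (ae_of_all _ fun x => ?_)
    rw [Real.norm_eq_abs]
    change |d x| ≤ 1 + (d x) ^ 2
    rcases le_total |d x| 1 with h | h
    · linarith [sq_nonneg (d x)]
    · have : |d x| ≤ |d x| ^ 2 := by nlinarith
      rw [sq_abs] at this; linarith
  have hfin : klDiv (μ₀.tilted φ) ((μ₀.tilted φ).map (fun x : PhaseSpace N => (x.1, -x.2))) ≠ ∞ :=
    (klDiv_flip_tilted_ne_top_iff hinv hφm hexp).2 h1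
  rw [← ENNReal.ofReal_toReal hfin, toReal_klDiv_flip_tilted hinv hφm hexp]
  refine ENNReal.ofReal_le_ofReal ?_
  -- reduce to weighted `μ₀`-integrals
  set Z := ∫ x, exp (φ x) ∂μ₀ with hZ
  have hZpos : 0 < Z := integral_exp_pos hexp
  have hw1 : Integrable (fun x => exp (φ x) * d x) μ₀ := by
    have := (integrable_tilted_iff hexp d).1 h1; simpa [smul_eq_mul] using this
  have hw2 : Integrable (fun x => exp (φ x) * d x ^ 2) μ₀ := by
    have := (integrable_tilted_iff hexp (fun x => d x ^ 2)).1 h2; simpa [smul_eq_mul] using this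
  have hw1' : Integrable (fun x => exp (φ (x.1, -x.2)) * d x) μ₀ := by
    have h := (integrable_comp_flip_iff μ₀ hinv (fun x => -(exp (φ x) * d x))).2 hw1.neg
    refine h.congr (ae_of_all _ fun x => ?_)
    simp only [hdodd x]; ring
  have hw2' : Integrable (fun x => exp (φ (x.1, -x.2)) * d x ^ 2) μ₀ := by
    have h := (integrable_comp_flip_iff μ₀ hinv (fun x => exp (φ x) * d x ^ 2)).2 hw2
    refine h.congr (ae_of_all _ fun x => ?_)
    simp only [hdodd x]; ring
  have hI1 : ∫ x, exp (φ (x.1, -x.2)) * d x ∂μ₀ = -∫ x, exp (φ x) * d x ∂μ₀ := by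
    rw [← integral_neg, ← integral_comp_flip μ₀ hinv (fun x => -(exp (φ x) * d x))]
    refine integral_congr_ae (ae_of_all _ fun x => ?_)
    simp only [hdodd x]; ring
  have hI2 : ∫ x, exp (φ (x.1, -x.2)) * d x ^ 2 ∂μ₀ = ∫ x, exp (φ x) * d x ^ 2 ∂μ₀ := by
    rw [← integral_comp_flip μ₀ hinv (fun x => exp (φ x) * d x ^ 2)]
    refine integral_congr_ae (ae_of_all _ fun x => ?_)
    simp only [hdodd x]; ring
  -- the SHARP pointwise inequality `d (e^φ − e^{φΘ}) ≤ ½ d² (e^φ + e^{φΘ})`, integrated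
  have hpt : ∀ x, exp (φ x) * d x - exp (φ (x.1, -x.2)) * d x ≤
      (exp (φ x) * d x ^ 2 + exp (φ (x.1, -x.2)) * d x ^ 2) / 2 := fun x => by
    have := sub_mul_exp_sub_exp_le_half (φ x) (φ (x.1, -x.2))
    simp only [hd] at this ⊢
    nlinarith [this]
  have hint : ∫ x, (exp (φ x) * d x - exp (φ (x.1, -x.2)) * d x) ∂μ₀ ≤
      ∫ x, (exp (φ x) * d x ^ 2 + exp (φ (x.1, -x.2)) * d x ^ 2) / 2 ∂μ₀ :=
    integral_mono (hw1.sub hw1') ((hw2.add hw2').div_const 2) hpt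
  rw [integral_sub hw1 hw1', integral_div, integral_add hw2 hw2', hI1, hI2] at hint
  -- so `∫ e^φ d ≤ ½ ∫ e^φ d²` w.r.t. `μ₀`; divide by `Z`
  have hkey : ∫ x, exp (φ x) * d x ∂μ₀ ≤ (∫ x, exp (φ x) * d x ^ 2 ∂μ₀) / 2 := by linarith
  rw [integral_tilted, integral_tilted]
  simp only [smul_eq_mul]
  have e1 : ∫ x, exp (φ x) / Z * d x ∂μ₀ = Z⁻¹ * ∫ x, exp (φ x) * d x ∂μ₀ := by
    rw [← integral_const_mul]; refine integral_congr_ae (ae_of_all _ fun x => ?_); ring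
  have e2 : ∫ x, exp (φ x) / Z * d x ^ 2 ∂μ₀ = Z⁻¹ * ∫ x, exp (φ x) * d x ^ 2 ∂μ₀ := by
    rw [← integral_const_mul]; refine integral_congr_ae (ae_of_all _ fun x => ?_); ring
  change ∫ x, exp (φ x) / Z * d x ∂μ₀ ≤ 1 / 2 * ∫ x, exp (φ x) / Z * (d x) ^ 2 ∂μ₀
  rw [e1, e2]
  have hZi : 0 ≤ Z⁻¹ := inv_nonneg.2 hZpos.le
  nlinarith [mul_le_mul_of_nonneg_left hkey hZi]

/-- **Specialisation to the pinned chain (sharp).** If a state of the `N`-site chain is the Gibbs state at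
temperature `T > 0` tilted by a measurable `φ` with `e^φ ∈ L¹(μ_T)` and `(φ − φ∘Θ)² ∈ L¹` of the tilted state,
then its snapshot divergence is at most `½ ∫ (φ − φ∘Θ)² d(tilted state)`. [folklore] -/
theorem klDiv_flip_gibbs_tilted_le_half {ω₂ lam β : ℝ} (hω : 0 < ω₂) (hl : 0 ≤ lam) (hβ : 0 ≤ β)
    (γ : ℝ) (N : ℕ) {T : ℝ} (hT : 0 < T) {φ : PhaseSpace N → ℝ} (hφm : Measurable φ)
    (hexp : Integrable (fun x => exp (φ x)) ((pinnedChain ω₂ lam β γ).gibbsMeasure N T))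
    (h2 : Integrable (fun x => (φ x - φ (x.1, -x.2)) ^ 2)
      (((pinnedChain ω₂ lam β γ).gibbsMeasure N T).tilted φ)) :
    klDiv (((pinnedChain ω₂ lam β γ).gibbsMeasure N T).tilted φ)
        ((((pinnedChain ω₂ lam β γ).gibbsMeasure N T).tilted φ).map
          (fun x : PhaseSpace N => (x.1, -x.2))) ≤
      ENNReal.ofReal ((1 / 2 : ℝ) * ∫ x, (φ x - φ (x.1, -x.2)) ^ 2
        ∂(((pinnedChain ω₂ lam β γ).gibbsMeasure N T).tilted φ)) := by
  haveI := pinnedChain_isProbabilityMeasure_gibbsMeasure hω hl hβ γ N hT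
  exact klDiv_flip_tilted_le_half_integral_sq (gibbsMeasure_map_flip (pinnedChain ω₂ lam β γ) N T)
    hφm hexp h2

/-! ## 3. Positive Lebesgue densities as Gibbs tilts -/


/-! ## 6. Intrinsic (density) form of the missing statement: positive Lebesgue density + `L²` bound on
the odd part of its logarithm — implies the Gibbs-tilt form -/

/-- A probability measure with an everywhere positive measurable Lebesgue density `ρ` is the Gibbs state at
temperature `T` (whenever `e^{-H/T}` is integrable) tilted by `log ρ + H/T`. [folklore] -/
theorem withDensity_eq_gibbs_tilted (P : OscillatorChain) (N : ℕ) (T : ℝ)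
    (hZ : Integrable (P.gibbsDensity N T)) {ρ : PhaseSpace N → ℝ}
    (hρpos : ∀ x, 0 < ρ x) (hρ1 : ∫ x, ρ x = 1) :
    (volume : Measure (PhaseSpace N)).withDensity (fun x => ENNReal.ofReal (ρ x)) =
      (P.gibbsMeasure N T).tilted (fun x => Real.log (ρ x) + P.hamiltonian N x / T) := by
  have hZ' : Integrable (fun x : PhaseSpace N => exp (-P.hamiltonian N x / T)) := hZ
  rw [P.gibbsMeasure_eq, tilted_tilted hZ']
  have hsum : ((fun x : PhaseSpace N => -P.hamiltonian N x / T) +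
      fun x => Real.log (ρ x) + P.hamiltonian N x / T) = fun x => Real.log (ρ x) := by
    funext x; simp only [Pi.add_apply]; ring
  have hexp : ∀ x, exp (log (ρ x)) = ρ x := fun x => Real.exp_log (hρpos x)
  have hint : ∫ x : PhaseSpace N, exp (log (ρ x)) = 1 := by
    rw [← hρ1]; exact integral_congr_ae (ae_of_all _ fun x => hexp x)
  rw [hsum]
  ext s hs
  rw [tilted_apply' _ _ hs, withDensity_apply _ hs]
  refine setLIntegral_congr_fun hs (fun x _ => ?_)
  rw [hexp x, hint, div_one]

/-- For a positive Lebesgue probability density `ρ`, `e^{log ρ + H/T}` is integrable against the Gibbs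
state at temperature `T` (its integral is `(∫ e^{-H/T})⁻¹ ∫ ρ`). [folklore] -/
theorem integrable_exp_log_add_hamiltonian_gibbs (P : OscillatorChain) (N : ℕ) (T : ℝ)
    (hZ : Integrable (P.gibbsDensity N T)) {ρ : PhaseSpace N → ℝ}
    (hρpos : ∀ x, 0 < ρ x) (hρint : Integrable ρ) :
    Integrable (fun x => exp (Real.log (ρ x) + P.hamiltonian N x / T)) (P.gibbsMeasure N T) := by
  have hZ' : Integrable (fun x : PhaseSpace N => exp (-P.hamiltonian N x / T)) := hZ
  rw [P.gibbsMeasure_eq, integrable_tilted_iff hZ']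
  refine hρint.congr (ae_of_all _ fun x => ?_)
  simp only [smul_eq_mul]
  rw [exp_add, Real.exp_log (hρpos x), show -P.hamiltonian N x / T = -(P.hamiltonian N x / T) by ring,
    exp_neg]
  have := exp_pos (P.hamiltonian N x / T)
  field_simp

/-! ## 4. S1c from the intrinsic log-density statement -/

/-- **Reduction `stub_snapshotKLUpper_of_density`** (registered sub-goal of the skeleton): the intrinsic first-order
control of the odd NESS log-density (hypothesis, verbatim the skeleton stub `stub_oddLogDensity`) implies S1c
`stub_snapshotKLUpper` (conclusion, verbatim). Proof: for `K > ½∫(h − h∘Θ)²` take `D := 2K`; on the eventual set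
(intersected with `T ± δ/2 > 0`, `eventually_bath_temps_pos`) write `μ_δ = μ_T.tilted φ` with `φ := log ρ_δ + H/T`
(`withDensity_eq_gibbs_tilted`; `∫ρ_δ = 1` since steady states are probability measures), note
`φ − φ∘Θ = log ρ_δ − log ρ_δ∘Θ` (`hamiltonian_neg_momentum`), and apply the sharp Gibbs-tilt bound:
`KL ≤ ½∫(φ − φ∘Θ)² dμ_δ ≤ ½·2K·δ² = Kδ²`. [folklore] -/
theorem stub_snapshotKLUpper_of_density :
    (∀ ω₂ lam β γ : ℝ, 0 < ω₂ → 0 < lam → 0 < β → 0 < γ →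
        (∀ (N : ℕ) (T_L T_R : ℝ), 0 < T_L → 0 < T_R → ∀ μ ν : Measure (PhaseSpace N),
          (pinnedChain ω₂ lam β γ).IsSteadyState N T_L T_R μ →
          (pinnedChain ω₂ lam β γ).IsSteadyState N T_L T_R ν → μ = ν) →
        ∀ μ : (N : ℕ) → ℝ → ℝ → Measure (PhaseSpace N),
          (∀ (N : ℕ) (T_L T_R : ℝ), 0 < T_L → 0 < T_R →
            (pinnedChain ω₂ lam β γ).IsSteadyState N T_L T_R (μ N T_L T_R)) →
          ∀ T : ℝ, 0 < T → ∀ N : ℕ, 2 ≤ N → ∀ h : PhaseSpace N → ℝ,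
            (MemLp h 2 (μ N T T) ∧
              (∀ F : PhaseSpace N → ℝ, ContDiff ℝ ((⊤ : ℕ∞) : WithTop ℕ∞) F → HasCompactSupport F →
                Tendsto (fun δ : ℝ => ((∫ x, F x ∂(μ N (T + δ / 2) (T - δ / 2))) - ∫ x, F x ∂(μ N T T)) / δ)
                  (𝓝[≠] (0 : ℝ)) (𝓝 (∫ x, F x * h x ∂(μ N T T)))) ∧
              (∀ i : Fin N, Tendsto (fun δ : ℝ =>
                  ((∫ x, (pinnedChain ω₂ lam β γ).bondCurrent N i x ∂(μ N (T + δ / 2) (T - δ / 2))) -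
                    ∫ x, (pinnedChain ω₂ lam β γ).bondCurrent N i x ∂(μ N T T)) / δ)
                  (𝓝[≠] (0 : ℝ)) (𝓝 (∫ x, (pinnedChain ω₂ lam β γ).bondCurrent N i x * h x ∂(μ N T T))))) →
            ∀ D : ℝ, ∫ x, (h x - h (x.1, -x.2)) ^ 2 ∂(μ N T T) < D →
              ∀ᶠ δ in 𝓝[≠] (0 : ℝ), ∃ ρ : PhaseSpace N → ℝ, Measurable ρ ∧ (∀ x, 0 < ρ x) ∧
                μ N (T + δ / 2) (T - δ / 2) =
                  (volume : Measure (PhaseSpace N)).withDensity (fun x => ENNReal.ofReal (ρ x)) ∧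
                Integrable (fun x => (Real.log (ρ x) - Real.log (ρ (x.1, -x.2))) ^ 2)
                  (μ N (T + δ / 2) (T - δ / 2)) ∧
                ∫ x, (Real.log (ρ x) - Real.log (ρ (x.1, -x.2))) ^ 2 ∂(μ N (T + δ / 2) (T - δ / 2))
                  ≤ D * δ ^ 2) →
    ∀ ω₂ lam β γ : ℝ, 0 < ω₂ → 0 < lam → 0 < β → 0 < γ →
      (∀ (N : ℕ) (T_L T_R : ℝ), 0 < T_L → 0 < T_R → ∀ μ ν : Measure (PhaseSpace N),
        (pinnedChain ω₂ lam β γ).IsSteadyState N T_L T_R μ →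
        (pinnedChain ω₂ lam β γ).IsSteadyState N T_L T_R ν → μ = ν) →
      ∀ μ : (N : ℕ) → ℝ → ℝ → Measure (PhaseSpace N),
        (∀ (N : ℕ) (T_L T_R : ℝ), 0 < T_L → 0 < T_R →
          (pinnedChain ω₂ lam β γ).IsSteadyState N T_L T_R (μ N T_L T_R)) →
        ∀ T : ℝ, 0 < T → ∀ N : ℕ, 2 ≤ N → ∀ h : PhaseSpace N → ℝ,
          (MemLp h 2 (μ N T T) ∧
            (∀ F : PhaseSpace N → ℝ, ContDiff ℝ ((⊤ : ℕ∞) : WithTop ℕ∞) F → HasCompactSupport F →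
              Tendsto (fun δ : ℝ => ((∫ x, F x ∂(μ N (T + δ / 2) (T - δ / 2))) - ∫ x, F x ∂(μ N T T)) / δ)
                (𝓝[≠] (0 : ℝ)) (𝓝 (∫ x, F x * h x ∂(μ N T T)))) ∧
            (∀ i : Fin N, Tendsto (fun δ : ℝ =>
                ((∫ x, (pinnedChain ω₂ lam β γ).bondCurrent N i x ∂(μ N (T + δ / 2) (T - δ / 2))) -
                  ∫ x, (pinnedChain ω₂ lam β γ).bondCurrent N i x ∂(μ N T T)) / δ)
                (𝓝[≠] (0 : ℝ)) (𝓝 (∫ x, (pinnedChain ω₂ lam β γ).bondCurrent N i x * h x ∂(μ N T T))))) →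
          ∀ K : ℝ, (1 / 2 : ℝ) * ∫ x, (h x - h (x.1, -x.2)) ^ 2 ∂(μ N T T) < K →
            ∀ᶠ δ in 𝓝[≠] (0 : ℝ),
              klDiv (μ N (T + δ / 2) (T - δ / 2))
                  (Measure.map (fun x : PhaseSpace N => (x.1, -x.2)) (μ N (T + δ / 2) (T - δ / 2)))
                ≤ ENNReal.ofReal (K * δ ^ 2) := by
  intro H ω₂ lam β γ hω hl hβ hγ hU μ hμ T hT N hN h hh K hK
  have hD : ∫ x, (h x - h (x.1, -x.2)) ^ 2 ∂(μ N T T) < 2 * K := by linarith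
  filter_upwards [H ω₂ lam β γ hω hl hβ hγ hU μ hμ T hT N hN h hh (2 * K) hD, eventually_bath_temps_pos hT]
    with δ hδ hTδ
  obtain ⟨ρ, hρm, hρpos, hμeq, h2, hbound⟩ := hδ
  set P := pinnedChain ω₂ lam β γ with hP
  have hprob : IsProbabilityMeasure (μ N (T + δ / 2) (T - δ / 2)) := (hμ N _ _ hTδ.1 hTδ.2).1
  have hl1 : ∫⁻ x, ENNReal.ofReal (ρ x) = 1 := by
    have h1 := hprob.measure_univ
    rw [hμeq, withDensity_apply _ MeasurableSet.univ, Measure.restrict_univ] at h1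
    exact h1
  have hρint : Integrable ρ :=
    ⟨hρm.aestronglyMeasurable, (hasFiniteIntegral_iff_ofReal (ae_of_all _ fun x => (hρpos x).le)).2
      (by rw [hl1]; exact ENNReal.one_lt_top)⟩
  have hρ1 : ∫ x, ρ x = 1 := by
    rw [integral_eq_lintegral_of_nonneg_ae (ae_of_all _ fun x => (hρpos x).le)
      hρm.aestronglyMeasurable, hl1]
    simp
  have hZ : Integrable (P.gibbsDensity N T) := pinnedChain_integrable_gibbsDensity hω hl.le hβ.le γ N hT
  set φ : PhaseSpace N → ℝ := fun x => Real.log (ρ x) + P.hamiltonian N x / T with hφ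
  have hφodd : ∀ x : PhaseSpace N, φ x - φ (x.1, -x.2) = Real.log (ρ x) - Real.log (ρ (x.1, -x.2)) := by
    intro x
    simp only [hφ, OscillatorChain.hamiltonian_neg_momentum]
    ring
  have hφm : Measurable φ :=
    (Real.measurable_log.comp hρm).add
      ((pinnedChain_contDiff_hamiltonian ω₂ lam β γ N (n := 0)).continuous.measurable.div_const T)
  have hexp : Integrable (fun x => exp (φ x)) (P.gibbsMeasure N T) :=
    integrable_exp_log_add_hamiltonian_gibbs P N T hZ hρpos hρint
  have hμt : μ N (T + δ / 2) (T - δ / 2) = (P.gibbsMeasure N T).tilted φ := by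
    rw [hμeq]; exact withDensity_eq_gibbs_tilted P N T hZ hρpos hρ1
  have h2' : Integrable (fun x => (φ x - φ (x.1, -x.2)) ^ 2) ((P.gibbsMeasure N T).tilted φ) := by
    rw [← hμt]; simp_rw [hφodd]; exact h2
  have hbound' : ∫ x, (φ x - φ (x.1, -x.2)) ^ 2 ∂((P.gibbsMeasure N T).tilted φ) ≤ 2 * K * δ ^ 2 := by
    rw [← hμt]; simp_rw [hφodd]; exact hbound
  rw [hμt]
  refine (klDiv_flip_gibbs_tilted_le_half hω hl.le hβ.le γ N hT hφm hexp h2').trans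
    (ENNReal.ofReal_le_ofReal ?_)
  nlinarith [hbound']

end Summit.AtomisticToContinuum.FouriersLaw.Theorems.ExtensiveSnapshotIrreversibility.ClausiusBudget

end
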